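import Summits.QuantumAdvantage.QuantumAdvantage.Theorems.MobiusLadderLiouvilleNotPPolyTwinKernel
import Literature.NumberTheory.QuadraticFields.KroneckerCharacterFourProofs
import Literature.NumberTheory.LFunctions.LiouvilleSumClassicalBound

/-!
# Stub `stub_twinDivisorSum` (T2a of line `Sketch`, crux `MobiusLadder.LiouvilleNotPPoly`,
stmt-QuantumAdvantage-1389)

A TWIN'S DIVISOR SUMS DETECT ODD SQUARES. Let `d` be a *Liouville twin of level `x`*
(`(d | p) = −1` for every odd prime `p ≤ x`) and let `χ` be a Dirichlet character mod `4|d|`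
with `χ(n) = (d | n)` for odd `n` (the Kronecker character of
`Literature.NumberTheory.QuadraticFields.exists_dirichletCharacter_four_mul`). For `1 ≤ m ≤ x`:

* the even divisors `e` of `m` contribute `χ(e) = 0` (`gcd(e, 4|d|) ≠ 1`);
* the odd divisors `e ≤ m ≤ x` have `χ(e) = (d | e) = λ(e)` by the landed kernel
  `jacobiSym_eq_liouville_of_twin`, and the odd divisors of `m` are the divisors of its odd part
  `ordCompl[2] m`;
* `∑_{e ∣ n} λ(e) = [n is a square]` (tree:
  `Literature.NumberTheory.LFunctions.LiouvilleSum.sum_divisors_liouville`).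

Hence `∑_{e ∣ m} χ(e) = [ordCompl[2] m is a square]`, so
`S(N) := ∑_{m=1}^{N} ∑_{e ∣ m} χ(e) = #{m ≤ N : m = 2^a k²}` for `N ≤ x`, and the
injection `m ↦ (a, k)` into `[0, log₂ N] × [0, √N]` gives `|S(N)| ≤ (log₂ N + 1)(√N + 1)`.

Helper lemmas live in the sub-namespace `TwinDivisorSum`; only `stub_twinDivisorSum` sits in
`Summit.QuantumAdvantage.QuantumAdvantage.Theorems.LiouvilleNotPPoly`.
-/

set_option linter.dupNamespace false -- D-0017: single-problem summit ⇒ `QuantumAdvantage.QuantumAdvantage` by design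

noncomputable section

namespace Summit.QuantumAdvantage.QuantumAdvantage.Theorems.LiouvilleNotPPoly

namespace TwinDivisorSum

open Finset

/-- The odd divisors of `m ≠ 0` are the divisors of its odd part `ordCompl[2] m`. -/
theorem filter_odd_divisors {m : ℕ} (hm : m ≠ 0) :
    m.divisors.filter Odd = (ordCompl[2] m).divisors := by
  ext e
  simp only [Finset.mem_filter, Nat.mem_divisors]
  constructor
  · rintro ⟨⟨hd, -⟩, ho⟩
    exact ⟨Nat.dvd_ordCompl_of_dvd_not_dvd hd fun h2 =>
      (Nat.not_even_iff_odd.2 ho) (even_iff_two_dvd.2 h2), (Nat.ordCompl_pos 2 hm).ne'⟩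
  · rintro ⟨hd, -⟩
    refine ⟨⟨hd.trans (Nat.ordCompl_dvd m 2), hm⟩, Nat.odd_iff.2 ?_⟩
    by_contra h
    have h2e : 2 ∣ e := Nat.dvd_of_mod_eq_zero (by omega)
    exact Nat.not_dvd_ordCompl Nat.prime_two hm (h2e.trans hd)

/-- A Dirichlet character mod `4|d|` vanishes at every even natural number (`gcd(e, 4|d|) ≠ 1`;
this holds at level `0` too, where the units of `ZMod 0 = ℤ` are `±1`). -/
theorem apply_natCast_eq_zero_of_even {d : ℤ} (χ : DirichletCharacter ℂ (4 * d.natAbs))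
    {e : ℕ} (he : Even e) : χ e = 0 := by
  refine MulChar.map_nonunit χ ?_
  rw [ZMod.isUnit_iff_coprime]
  intro hcop
  have h2 : Nat.Coprime 2 2 :=
    (hcop.coprime_dvd_left (even_iff_two_dvd.1 he)).coprime_dvd_right ⟨2 * d.natAbs, by ring⟩
  norm_num at h2

/-- **The divisor sums of a twin's character detect odd squares**: for a twin `d` of level `x`,
a character `χ` mod `4|d|` with `χ(n) = (d | n)` at odd `n`, and `1 ≤ m ≤ x`,
`∑_{e ∣ m} χ(e) = [ordCompl[2] m is a square]`. -/
theorem sum_divisors_apply_eq {d : ℤ} {x : ℕ}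
    (h : ∀ p : ℕ, p.Prime → p ≠ 2 → p ≤ x → jacobiSym d p = -1)
    (χ : DirichletCharacter ℂ (4 * d.natAbs))
    (hχ : ∀ n : ℕ, Odd n → χ n = (jacobiSym d n : ℂ)) {m : ℕ} (hm : m ≠ 0) (hmx : m ≤ x) :
    ∑ e ∈ m.divisors, χ e = if IsSquare (ordCompl[2] m) then 1 else 0 := by
  have hval : ∀ e ∈ m.divisors,
      χ e = if Odd e then ((ArithmeticFunction.liouville e : ℤ) : ℂ) else 0 := by
    intro e he
    have hem : e ∣ m := Nat.dvd_of_mem_divisors he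
    have he0 : e ≠ 0 := fun h0 => hm (Nat.eq_zero_of_zero_dvd (h0 ▸ hem))
    split_ifs with ho
    · rw [hχ e ho, jacobiSym_eq_liouville_of_twin h e he0 ho
        ((Nat.le_of_dvd (Nat.pos_of_ne_zero hm) hem).trans hmx)]
    · exact apply_natCast_eq_zero_of_even χ (Nat.not_odd_iff_even.1 ho)
  rw [Finset.sum_congr rfl hval, ← Finset.sum_filter, filter_odd_divisors hm, ← Int.cast_sum,
    Literature.NumberTheory.LFunctions.LiouvilleSum.sum_divisors_liouville
      (Nat.ordCompl_pos 2 hm).ne']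
  split_ifs <;> simp

/-- **Counting**: the `m ∈ [1, N]` whose odd part is a square number at most
`(log₂ N + 1)(√N + 1)` (inject `m = 2^a k² ↦ (a, k)` with `a ≤ log₂ N`, `k ≤ √N`). -/
theorem card_filter_isSquare_ordCompl_le (N : ℕ) :
    ((Finset.Icc 1 N).filter fun m => IsSquare (ordCompl[2] m)).card ≤
      (Nat.log 2 N + 1) * (Nat.sqrt N + 1) := by
  calc ((Finset.Icc 1 N).filter fun m => IsSquare (ordCompl[2] m)).card
      ≤ (range (Nat.log 2 N + 1) ×ˢ range (Nat.sqrt N + 1)).card := by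
        refine Finset.card_le_card_of_injOn
          (fun m => (m.factorization 2, Nat.sqrt (ordCompl[2] m))) ?_ ?_
        · intro m hm
          obtain ⟨hmI, -⟩ := Finset.mem_filter.1 (Finset.mem_coe.1 hm)
          rw [Finset.mem_Icc] at hmI
          have hm0 : m ≠ 0 := by omega
          refine Finset.mem_coe.2
            (Finset.mem_product.2 ⟨Finset.mem_range.2 ?_, Finset.mem_range.2 ?_⟩)
          · exact Nat.lt_succ_of_le
              (Nat.le_log_of_pow_le one_lt_two ((Nat.ordProj_le 2 hm0).trans hmI.2))
          · exact Nat.lt_succ_of_le (Nat.sqrt_le_sqrt ((Nat.ordCompl_le m 2).trans hmI.2))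
        · intro m₁ hm₁ m₂ hm₂ hf
          obtain ⟨-, r₁, hr₁⟩ := Finset.mem_filter.1 (Finset.mem_coe.1 hm₁)
          obtain ⟨-, r₂, hr₂⟩ := Finset.mem_filter.1 (Finset.mem_coe.1 hm₂)
          simp only [Prod.mk.injEq] at hf
          obtain ⟨h1, h2⟩ := hf
          have hoc : ordCompl[2] m₁ = ordCompl[2] m₂ := by
            rw [hr₁, hr₂] at h2 ⊢
            rw [Nat.sqrt_eq, Nat.sqrt_eq] at h2
            rw [h2]
          calc m₁ = ordProj[2] m₁ * ordCompl[2] m₁ :=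
                (Nat.ordProj_mul_ordCompl_eq_self m₁ 2).symm
            _ = ordProj[2] m₂ * ordCompl[2] m₂ := by rw [hoc, h1]
            _ = m₂ := Nat.ordProj_mul_ordCompl_eq_self m₂ 2
    _ = (Nat.log 2 N + 1) * (Nat.sqrt N + 1) := by
        rw [Finset.card_product, Finset.card_range, Finset.card_range]

end TwinDivisorSum

open TwinDivisorSum in
/-- **Stub T2a · `stub_twinDivisorSum`** — A TWIN'S DIVISOR SUMS DETECT ODD SQUARES: for a
twin `d` of level `x` (`(d | p) = −1` at every odd prime `p ≤ x`) and a Dirichlet character `χ`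
mod `4|d|` with `χ(n) = (d | n)` for odd `n`, `∑_{e ∣ m} χ(e) = [the odd part of m is a square]`
for `1 ≤ m ≤ x`, whence `‖∑_{m=1}^{N} ∑_{e ∣ m} χ(e)‖ ≤ (log₂ N + 1)(√N + 1)` for `N ≤ x`. -/
theorem stub_twinDivisorSum :
    ∀ (d : ℤ) (x : ℕ), (∀ p : ℕ, p.Prime → p ≠ 2 → p ≤ x → jacobiSym d p = -1) →
      ∀ χ : DirichletCharacter ℂ (4 * d.natAbs),
      (∀ n : ℕ, Odd n → χ n = (jacobiSym d n : ℂ)) → ∀ N : ℕ, N ≤ x →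
        ‖∑ m ∈ Finset.Icc 1 N, ∑ e ∈ m.divisors, χ e‖ ≤
          ((Nat.log 2 N + 1) * (Nat.sqrt N + 1) : ℕ) := by
  intro d x h χ hχ N hN
  have hS : ∑ m ∈ Finset.Icc 1 N, ∑ e ∈ m.divisors, χ e =
      (((Finset.Icc 1 N).filter fun m => IsSquare (ordCompl[2] m)).card : ℂ) := by
    rw [Finset.natCast_card_filter]
    refine Finset.sum_congr rfl fun m hm => ?_
    rw [Finset.mem_Icc] at hm
    exact sum_divisors_apply_eq h χ hχ (by omega) (hm.2.trans hN)
  rw [hS, Complex.norm_natCast]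
  exact_mod_cast card_filter_isSquare_ordCompl_le N

end Summit.QuantumAdvantage.QuantumAdvantage.Theorems.LiouvilleNotPPoly

end
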